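import Summits.BirchSwinnertonDyer.BirchSwinnertonDyer.Theorems.ResidualThetaTransportAtTwoResidualSignedLambdaLowerCMAtTwoPairingSumOnto
import Summits.BirchSwinnertonDyer.BirchSwinnertonDyer.Theorems.ThetaPartnerAtTwoSignedMainConjectureCMTwoRankZeroStubPlusHondaSystemCMTwo
import Summits.BirchSwinnertonDyer.BirchSwinnertonDyer.Theorems.ThetaPartnerAtTwoSignedControlAtTwoLocalNonDivTwo
import Summits.BirchSwinnertonDyer.BirchSwinnertonDyer.Theorems.ByReductionTypeAtTwoSupersingularTowerTorsionTwo
import Literature.NumberTheory.EllipticCurves.CyclotomicZpExtensionLocalGeneratorProofs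
import Literature.NumberTheory.EllipticCurves.Sprung2012.LocalTowerTraceProofs
import Literature.NumberTheory.EllipticCurves.Sprung2012.LocalTowerLayersProofs
import Literature.Algebra.Module.PadicFunctionalSeparation
import HarnessLib

/-!
# `Col⁺` IS ONTO AT `p = 2` on the cyclotomic `ℤ₂`-tower `ℚ_{2,n} = ℚ₂(ζ_{2^{n+2}})⁺`, for EVERY globally minimal `W/ℚ` with
# `GoodSS W 2`, `a₂(W) = 0` — Kobayashi's Theorem 6.2 (plus half) at the prime `2`, unconditionally

Route `ResidualThetaTransportAtTwo` (RTT), crux RSL_g `ResidualSignedLambdaLowerCMAtTwo` (stmt-BirchSwinnertonDyer-22608; node N1 «local⁺ at 2»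
of `Cruxes/ResidualThetaCountLowerPureAtTwo/RSLG-LINE-DAG-g14.md`, `CSCAN-SIGNED-AT-TWO-g14.md` §3/§3bis). Seat `prover-bsd-wall-rtt-p2` g14
(`--supports`, closes nothing). HONEST FRAMING: THEOREMS ONLY (no definition, no named fact, no instance, no `sorry`); a LOCAL statement about the
formal group of `W` at `2` in Sprung's functional model of `H¹_Iw` (`Hom(E(ℚ_{2,∞}·ℚ_v), ℤ₂)`, Lemma 7.10); nothing about any Selmer group or
`L`-function; BSD is not proved by any of this. What it settles: the decisive local risk named for RSL_g by `bsd-vet-rslg` g0 (VET-RSLG-g0.md §6,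
«λ(coker Col at 2) > 0 would make RSL_g false») — on the PLUS side (the side of S2 / `Lm`) the cokernel is ZERO at every finite level.

## Statement (`exists_pairingSum_eq_omegaMinus_mul_two`)
For `W/ℚ` globally minimal, `GoodSS W 2`, `a₂(W) = 0`, the cyclotomic `κ : ZpExtension ℚ 2`, the place `v ∋ 2`, ANY local lift `g ∈ Γ_{ℚ_v}` of
the topological generator (`κ(res g) = 1`) and ANY family `d : ℕ → E(K̄_v)` with (L) `d m ∈ E(ℚ_{2,m}·ℚ_v)`, (TR)
`Tr_{m+2/m+1} d_{m+2} = −d_m` and (ND) `d_0 ∉ 2·E(ℚ_v)` — e.g. the HONDA⁺@2 system (`exists_plusHonda_nonDiv_two`: (ND) follows from its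
(GEN₀) and LEV0@2) — and every `m`, `a ∈ Λ = ℤ₂⟦T⟧`: there is a functional `z` on `E(ℚ_{2,∞}·ℚ_v)` with
**`ω_{2m} ∣ P_{2m, d_{2m}}(z) − ω⁻_{2m}·a`**. With `…PairingSumOmegaDivisibility` (`ω⁻_{2m} ∣ P_{2m,d_{2m}}(z)` for all `z`) this says:
the image of Kobayashi's `P⁺_{2m}` is EXACTLY `ω̃⁻_{2m}Λ_{2m}`, i.e. `Col⁺_{2m} : H¹(ℚ_{2,2m}, T)/H¹_+ → Λ_{2m}/(Xω⁺_{2m})` is surjective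
(Kobayashi Thm. 6.2 (6.10) / Prop. 8.23, printed for odd `p`), at `p = 2`. `hondaPlus_onto_two` packages it with the HONDA⁺@2 family.

## Proof (= `Sprung2012/ColemanMapSurjectiveProofs.lean` steps 1–4 at `p = 2`, plus side)
(TR) in `localTraceOfEmb` form is `∑_{s<2} g^{2^{m+1}s} • d_{m+2} = −d_m` (`Sprung2012.localTraceOfEmb_succ_eq_sum_pow_smul`), (L) gives
`g^{2^m} • d_m = d_m` (`Sprung2012.pow_mul_smul_of_mem_localLayerPointsOfEmb`); the tower `E(ℚ_{2,∞}·ℚ_v)` is `Γ_{ℚ_v}`-stable and has no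
`2`-torsion (`SSFlatEC.eq_zero_of_mem_localTowerPointsOfEmb_of_two_nsmul`, Sprung Lemma 2.3 at 2), so `E(ℚ_v)` is `2`-saturated in it
(`Sprung2012.mem_localLayerPointsOfEmb_of_pow_nsmul_mem`) and (ND) propagates to the tower; Pontryagin separation
(`Literature.Algebra.Module.exists_addMonoidHom_padicInt_not_dvd`) gives `z₀` with `2 ∤ z₀(d_0)`; then
`SignedColemanImage.exists_pairingSum_eq_omegaMinus_mul` (p655125: unit criterion `u(0) = ±z₀(d_0)` and the `Λ`-action).

References: [Kobayashi2003] Thm. 6.2, Prop. 8.23 (pp. 11, 22); [Sprung2012] Prop. 7.3, Lemma 7.10 (pp. 1500–1503); [KuriharaOtsuki2006] p. 559 (the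
plus/minus formalism at `p = 2`, `a₂ = 0`: «can be studied by the same method as for `p > 2`»).
-/

set_option autoImplicit false
-- the Theorems namespace of this sub repeats the summit name by design (D-0017 nested layout)
set_option linter.dupNamespace false

noncomputable section

open scoped Classical
open Polynomial Finset NumberField IsDedekindDomain

namespace Summit.BirchSwinnertonDyer.BirchSwinnertonDyer.Theorems.SignedColemanImage

open Literature.NumberTheory.EllipticCurves Literature.NumberTheory.EllipticCurves.Kobayashi2003
  Literature.NumberTheory.EllipticCurves.Sprung2017 Literature.NumberTheory.EllipticCurves.Rank1Residual WeierstrassCurve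

variable (W : WeierstrassCurve ℚ) [W.IsElliptic] [W.IsGloballyMinimal]

/-- **`Col⁺` is onto at `2`**: see the module docstring. For a local lift `g` of the topological generator, a family `d` with (L), (TR) (in
Kobayashi's trace form) and (ND) `d_0 ∉ 2·E(ℚ_v)`, every `ω⁻_{2m}·a` is a value of `P_{2m, d_{2m}}` on some functional of the tower
`E(ℚ_{2,∞}·ℚ_v)`, modulo `ω_{2m}`. [cite: Kobayashi2003, Thm. 6.2 (6.10) and Prop. 8.23 (pp. 11, 22)] [cite: Sprung2012, Prop. 7.3 (p. 1500)] -/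
theorem exists_pairingSum_eq_omegaMinus_mul_two (hss : GoodSS W 2) (κ : ZpExtension ℚ 2)
    (v : HeightOneSpectrum (𝓞 ℚ)) (hv : (2 : 𝓞 ℚ) ∈ v.asIdeal)
    {g : Field.absoluteGaloisGroup (v.adicCompletion ℚ)}
    (hg : κ.IsTopGenerator (resGalOfEmb (closureEmb (K := ℚ) (v.adicCompletion ℚ)) g))
    (d : ℕ → localPoints W (v.adicCompletion ℚ))
    (hL : ∀ m, d m ∈ localLayerPointsOfEmb κ (closureEmb (K := ℚ) (v.adicCompletion ℚ)) W m)
    (hTR : ∀ m, localTraceOfEmb κ (closureEmb (K := ℚ) (v.adicCompletion ℚ)) W (m + 1) (m + 2) (d (m + 2)) = -d m)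
    (hND : ∀ b ∈ localLayerPointsOfEmb κ (closureEmb (K := ℚ) (v.adicCompletion ℚ)) W 0, d 0 ≠ 2 • b)
    (m : ℕ) (a : PowerSeries ℤ_[2]) :
    ∃ z : Sprung2012.localTowerPointsOfEmb κ (closureEmb (K := ℚ) (v.adicCompletion ℚ)) W →+ ℤ_[2],
      toIwasawa 2 (cyclotomicOmega 2 (2 * m)) ∣
        Sprung2012.pairingSum W (Sprung2012.localTowerPointsOfEmb κ (closureEmb (K := ℚ) (v.adicCompletion ℚ)) W) g (2 * m)
            (d (2 * m)) z -
          toIwasawa 2 (cyclotomicOmegaMinus 2 (2 * m)) * a := by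
  set ι := closureEmb (K := ℚ) (v.adicCompletion ℚ) with hι
  set A := Sprung2012.localTowerPointsOfEmb κ ι W with hAdef
  -- the tower is `Γ`-stable, contains the orbits, and has no `2`-torsion
  have hAinv : ∀ x ∈ A, g⁻¹ • x ∈ A := fun x hx ↦ Sprung2012.smul_mem_localTowerPointsOfEmb κ ι W g⁻¹ hx
  have hdA : ∀ n, d n ∈ A := fun n ↦ Sprung2012.localLayerPointsOfEmb_le_localTowerPointsOfEmb κ ι W n (hL n)
  have hA : ∀ n j, g ^ j • d n ∈ A := fun n j ↦ Sprung2012.smul_mem_localTowerPointsOfEmb κ ι W _ (hdA n)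
  have hnt : ∀ P ∈ A, 2 • P = 0 → P = 0 := fun P hP h2 ↦
    SSFlatEC.eq_zero_of_mem_localTowerPointsOfEmb_of_two_nsmul W hss κ hv ι hP h2
  -- (L) ⟹ `g^{2^n}` fixes `d_n`; (TR) ⟹ the trace relation through powers of `g`
  have hfix : ∀ n, g ^ 2 ^ n • d n = d n := fun n ↦ by
    simpa using Sprung2012.pow_mul_smul_of_mem_localLayerPointsOfEmb κ ι W hg (hL n) 1
  have htr : ∀ n, ∑ s ∈ range 2, g ^ (2 ^ (n + 1) * s) • d (n + 2) = -d n := fun n ↦ by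
    rw [← Sprung2012.localTraceOfEmb_succ_eq_sum_pow_smul κ ι W hg (n + 1) (hL (n + 2))]
    exact hTR n
  -- (ND) propagates to the tower (`E(ℚ_v)` is `2`-saturated there), and Pontryagin separation gives `z₀` with `2 ∤ z₀(d_0)`
  have hN : ∀ y : A, 2 • y = 0 → y = 0 := fun y hy ↦
    Subtype.ext (hnt y y.2 (by rw [← AddSubgroupClass.coe_nsmul, hy]; rfl))
  have hn : ∀ y : A, 2 ^ 1 • y ≠ ⟨d 0, hdA 0⟩ := by
    intro y hy
    have hy' : 2 ^ 1 • (y : localPoints W (v.adicCompletion ℚ)) = d 0 := by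
      rw [← AddSubgroupClass.coe_nsmul, hy]
    have hmem : (y : localPoints W (v.adicCompletion ℚ)) ∈ localLayerPointsOfEmb κ ι W 0 :=
      Sprung2012.mem_localLayerPointsOfEmb_of_pow_nsmul_mem κ ι W hnt y.2 (by rw [hy']; exact hL 0)
    exact hND y hmem (by rw [← hy', pow_one])
  obtain ⟨z₀, hz₀⟩ := Literature.Algebra.Module.exists_addMonoidHom_padicInt_not_dvd (p := 2) hN hn
  have hunit : IsUnit (z₀ ⟨d 0, hdA 0⟩) := by
    rw [PadicInt.isUnit_iff]
    by_contra h
    exact hz₀ (by rw [pow_one]; exact (PadicInt.norm_lt_one_iff_dvd _).mp (lt_of_le_of_ne (PadicInt.norm_le_one _) h))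
  exact exists_pairingSum_eq_omegaMinus_mul W A g hAinv d hA hfix htr z₀ hunit m a

/-- **The HONDA⁺@2 family is not `2`-divisible at the bottom**: for `W/ℚ` globally minimal with `GoodSS W 2`, `a₂(W) = 0`, the cyclotomic `κ`
and `v ∋ 2`, there is a family `d` with (L), (TR) (the clauses of `SignedEC.PlusLayer.plusHondaSystemTwo_adicCompletion`) AND (ND)
`d_0 ∉ 2·E(ℚ_v)` — (ND) from (GEN₀) `E(ℚ_v) = ℤ·d_0 + 2E(ℚ_v)` and LEV0@2 `E(ℚ_v) ≠ 2E(ℚ_v)`.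
[cite: Kobayashi2003, Prop. 8.12 i) and Cor. 8.13 (p. 18)] [cite: MilneADT2006, I Lemma 3.3] -/
theorem exists_plusHonda_nonDiv_two (hss : GoodSS W 2) (ha : W.frobeniusTrace 2 = 0) (κ : ZpExtension ℚ 2) (hκ : κ.IsCyclotomic)
    (v : HeightOneSpectrum (𝓞 ℚ)) (hv : (2 : 𝓞 ℚ) ∈ v.asIdeal) :
    ∃ d : ℕ → localPoints W (v.adicCompletion ℚ),
      (∀ m, d m ∈ localLayerPointsOfEmb κ (closureEmb (K := ℚ) (v.adicCompletion ℚ)) W m) ∧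
      (∀ m, localTraceOfEmb κ (closureEmb (K := ℚ) (v.adicCompletion ℚ)) W (m + 1) (m + 2) (d (m + 2)) = -d m) ∧
      (∀ b ∈ localLayerPointsOfEmb κ (closureEmb (K := ℚ) (v.adicCompletion ℚ)) W 0, d 0 ≠ 2 • b) := by
  obtain ⟨d, hd, htr, -, hgen0⟩ := SignedEC.PlusLayer.plusHondaSystemTwo_adicCompletion W hss ha κ hκ v hv
  obtain ⟨m₀, hm₀, hne⟩ := SignedEC.exists_mem_localLayerPointsOfEmb_zero_ne_two_nsmul W κ v hv
  refine ⟨d, hd, htr, fun b hb hdb ↦ ?_⟩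
  obtain ⟨c, R, hR, hm₀eq⟩ := hgen0 m₀ hm₀
  refine hne (c • b + R) (AddSubgroup.add_mem _ (AddSubgroup.zsmul_mem _ hb c) hR) ?_
  rw [hm₀eq, hdb, smul_add, smul_comm]

/-- **Kobayashi's Theorem 6.2 (plus half) at `p = 2`, packaged**: for `W/ℚ` globally minimal with `GoodSS W 2`, `a₂(W) = 0`, the cyclotomic
`κ` and `v ∋ 2`, there are a local lift `g` of the topological generator and a plus Honda family `d` ((L), (TR), (ND)) such that at every
even level the plus Coleman functional is ONTO: `∀ m a, ∃ z, ω_{2m} ∣ P_{2m,d_{2m}}(z) − ω⁻_{2m}·a`.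
[cite: Kobayashi2003, Thm. 6.2 (6.10), Prop. 8.23 (pp. 11, 22)] [cite: Sprung2012, Prop. 7.3 (p. 1500)] -/
theorem hondaPlus_onto_two (hss : GoodSS W 2) (ha : W.frobeniusTrace 2 = 0) (κ : ZpExtension ℚ 2) (hκ : κ.IsCyclotomic)
    (v : HeightOneSpectrum (𝓞 ℚ)) (hv : (2 : 𝓞 ℚ) ∈ v.asIdeal) :
    ∃ (g : Field.absoluteGaloisGroup (v.adicCompletion ℚ)) (d : ℕ → localPoints W (v.adicCompletion ℚ)),
      κ.IsTopGenerator (resGalOfEmb (closureEmb (K := ℚ) (v.adicCompletion ℚ)) g) ∧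
      (∀ m, d m ∈ localLayerPointsOfEmb κ (closureEmb (K := ℚ) (v.adicCompletion ℚ)) W m) ∧
      (∀ m, localTraceOfEmb κ (closureEmb (K := ℚ) (v.adicCompletion ℚ)) W (m + 1) (m + 2) (d (m + 2)) = -d m) ∧
      (∀ b ∈ localLayerPointsOfEmb κ (closureEmb (K := ℚ) (v.adicCompletion ℚ)) W 0, d 0 ≠ 2 • b) ∧
      ∀ (m : ℕ) (a : PowerSeries ℤ_[2]),
        ∃ z : Sprung2012.localTowerPointsOfEmb κ (closureEmb (K := ℚ) (v.adicCompletion ℚ)) W →+ ℤ_[2],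
          toIwasawa 2 (cyclotomicOmega 2 (2 * m)) ∣
            Sprung2012.pairingSum W (Sprung2012.localTowerPointsOfEmb κ (closureEmb (K := ℚ) (v.adicCompletion ℚ)) W) g (2 * m)
                (d (2 * m)) z -
              toIwasawa 2 (cyclotomicOmegaMinus 2 (2 * m)) * a := by
  obtain ⟨g, hg⟩ := ZpExtension.IsCyclotomic.exists_isTopGenerator_resGalOfEmb_adicCompletion hκ v hv
  obtain ⟨d, hL, hTR, hND⟩ := exists_plusHonda_nonDiv_two W hss ha κ hκ v hv
  exact ⟨g, d, hg, hL, hTR, hND, fun m a ↦ exists_pairingSum_eq_omegaMinus_mul_two W hss κ v hv hg d hL hTR hND m a⟩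

end Summit.BirchSwinnertonDyer.BirchSwinnertonDyer.Theorems.SignedColemanImage

end
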